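import Mathlib
import HarnessLib
import Summits.AtomisticToContinuum.FouriersLaw.Theses.JunctionLocality
import Summits.AtomisticToContinuum.FouriersLaw.Theses.FeketeSeriesLaw

/-!
# Strategy census, generation 2, instance EDM — typed companions for crux
`JunctionLocality.ConductanceLowerBound` (stmt-AtomisticToContinuum-11749)

Crux-strategist seat `cstrat-stmt-AtomisticToContinuum-11749-s2`, instance EDM (one of several
concurrent instances of the seat; see `STRATEGY-CENSUS.md`, index of instance files), 2026-08-17.
Companion of `STRATEGY-CENSUS-s2-addendum-EDM.md`.  Like `StrategyCensus.lean` (s1),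
`StrategyCensusS2.lean` (instance JL) and `StrategyCensusS2LCR.lean` (instance LCR), this file only
TYPES statements over the existing declarations and PROVES elementary implications (`sorry`-free);
it registers no line (no `stub_*`, no composition); the live skeleton is untouched.

What is here and NOT in the other companions: the three scale-comparison strengthenings of the
crux in their weakest sufficient forms, with the real-analysis glue, so that the census can state
the exact slack each one leaves to a future engine.

* §0 pure real-sequence lemmas: `seq_floor_of_summableDefect`, `seq_floor_of_halving`
  (doubling sequence `N_j − 1 = 2^j (N₀ − 1)`), the de Bruijn–Erdős dyadic block lemma
  `seq_linear_of_quasiSubadditive` + `exists_dyadic_block` + `dyadic_sum_le_of_doubling`.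
* §1 `InFrame` (the crux frame as a functional of its conclusion; `Iff.rfl` instances).
* §2 (E3) `SummableDefectMonotone` — `(1 − a_N) D_N ≤ D_{N+1}` beyond `N₀`, `a ≥ 0` summable —
  and `conductanceLowerBound_of_summableDefectMonotone` (PROVED).  Between instance JL's
  `AlmostMonotoneResponse(θ)` and instance LCR's `EventualMonotoneResponse`.
* §3 (E2) `HalvingLaw` — per-bond transmission at most HALVES when the number of bonds at most
  DOUBLES: `(M−1)·D_N ≤ 2(N−1)·D_M` for `N₀ ≤ N ≤ M ≤ 2N−1` — and
  `conductanceLowerBound_of_halvingLaw` (PROVED): with the sharp constant `2` the doubling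
  comparison ALONE gives the floor (instance JL's `DoublingHarnack(θ)` needs a second piece
  `DyadicFloor` precisely because `θ` is free); `halvingLaw_of_eventuallyMonotone` (PROVED).
* §4 (E1) `SublinearSeriesLaw` — quasi-subadditivity of `R_N = (N−1)/D_N` with a SUB-LINEAR
  defect `C (N+M)^θ`, `0 ≤ θ < 1` — and `conductanceLowerBound_of_sublinearSeriesLaw` (PROVED, via
  the de Bruijn–Erdős lemma instead of Fekete); `sublinearSeriesLaw_of_quasiSubadditiveResistance`
  (PROVED): it is implied by route FeketeSeriesLaw's crux `QuasiSubadditiveResistance`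
  (stmt-14041, constant defect) and is immune to that item's recorded failure mode "finite-size
  corrections slower than 1/N".  The weakest series-law supplier of the crux on record.
-/

noncomputable section

open MeasureTheory Filter Topology Finset
open Literature.MathematicalPhysics.KineticTheory.HeatConduction

namespace Summit.AtomisticToContinuum.FouriersLaw.Cruxes.ConductanceLowerBound.StrategyCensusS2EDM

open Summit.AtomisticToContinuum.FouriersLaw.Theses.JunctionLocality

/-! ## §0 Pure real-sequence lemmas -/


/-- For `0 ≤ a ≤ 1/2`: `exp (-2a) ≤ 1 - a`. -/
theorem exp_neg_two_mul_le {a : ℝ} (h0 : 0 ≤ a) (h1 : a ≤ 1 / 2) :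
    Real.exp (-2 * a) ≤ 1 - a := by
  have hexp : 2 * a + 1 ≤ Real.exp (2 * a) := Real.add_one_le_exp (2 * a)
  have hpos : 0 < Real.exp (2 * a) := Real.exp_pos _
  have hone : 1 ≤ (1 - a) * Real.exp (2 * a) := by nlinarith
  calc Real.exp (-2 * a) = Real.exp (-2 * a) * 1 := by ring
    _ ≤ Real.exp (-2 * a) * ((1 - a) * Real.exp (2 * a)) :=
        mul_le_mul_of_nonneg_left hone (Real.exp_pos _).le
    _ = (1 - a) * (Real.exp (-2 * a) * Real.exp (2 * a)) := by ring
    _ = 1 - a := by rw [← Real.exp_add]; simp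

/-- **Summable-defect monotonicity gives a floor.** If `(1 - a N) D N ≤ D (N+1)` for `N ≥ N₀` with
`0 ≤ a ≤ 1/2` beyond `N₀`, `a ≥ 0` summable, then `D N ≥ D N₀ · exp (-2 ∑' a)` for `N ≥ N₀`. -/
theorem seq_floor_of_summableDefect {D a : ℕ → ℝ} {N₀ : ℕ}
    (ha0 : ∀ N, 0 ≤ a N) (ha1 : ∀ N, N₀ ≤ N → a N ≤ 1 / 2) (has : Summable a)
    (hstep : ∀ N, N₀ ≤ N → (1 - a N) * D N ≤ D (N + 1)) (hpos : 0 ≤ D N₀) :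
    ∀ N, N₀ ≤ N → D N₀ * Real.exp (-2 * ∑' k, a k) ≤ D N := by
  have key : ∀ N, N₀ ≤ N → D N₀ * Real.exp (-2 * ∑ k ∈ Ico N₀ N, a k) ≤ D N := by
    intro N hN
    induction N, hN using Nat.le_induction with
    | base => simp
    | succ n hn ih =>
      have hexp : Real.exp (-2 * a n) ≤ 1 - a n := exp_neg_two_mul_le (ha0 n) (ha1 n hn)
      have hDn : 0 ≤ D n := le_trans (by positivity) ih
      calc D N₀ * Real.exp (-2 * ∑ k ∈ Ico N₀ (n + 1), a k)
          = D N₀ * Real.exp (-2 * ∑ k ∈ Ico N₀ n, a k) * Real.exp (-2 * a n) := by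
            rw [Finset.sum_Ico_succ_top hn, mul_add, Real.exp_add, mul_assoc]
        _ ≤ D n * Real.exp (-2 * a n) :=
            mul_le_mul_of_nonneg_right ih (Real.exp_pos _).le
        _ ≤ D n * (1 - a n) := mul_le_mul_of_nonneg_left hexp hDn
        _ = (1 - a n) * D n := by ring
        _ ≤ D (n + 1) := hstep n hn
  intro N hN
  refine le_trans ?_ (key N hN)
  have hsum : ∑ k ∈ Ico N₀ N, a k ≤ ∑' k, a k :=
    has.sum_le_tsum (Ico N₀ N) (fun k _ => ha0 k)
  have hexp : Real.exp (-2 * ∑' k, a k) ≤ Real.exp (-2 * ∑ k ∈ Ico N₀ N, a k) :=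
    Real.exp_le_exp.mpr (by linarith)
  exact mul_le_mul_of_nonneg_left hexp hpos

/-- **Halving law gives a floor.** If for all `N ≥ N₀` (`N₀ ≥ 2`) and `N ≤ M ≤ 2N - 1` one has
`(M - 1) D N ≤ 2 (N - 1) D M` (per-bond transmission at most halves when the number of bonds at
most doubles), and `0 ≤ D N₀`, then `D M ≥ D N₀ / 2` for all `M ≥ N₀`. -/
theorem seq_floor_of_halving {D : ℕ → ℝ} {N₀ : ℕ} (hN₀ : 2 ≤ N₀)
    (h : ∀ N, N₀ ≤ N → ∀ M, N ≤ M → M + 1 ≤ 2 * N →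
      ((M : ℝ) - 1) * D N ≤ 2 * ((N : ℝ) - 1) * D M)
    (hpos : 0 ≤ D N₀) : ∀ M, N₀ ≤ M → D N₀ / 2 ≤ D M := by
  obtain ⟨K, rfl⟩ : ∃ K, N₀ = K + 1 := ⟨N₀ - 1, by omega⟩
  have hK : 1 ≤ K := by omega
  -- the doubling sequence `Nj j = 2^j K + 1` (so `Nj j - 1` doubles)
  set Nj : ℕ → ℕ := fun j => 2 ^ j * K + 1 with hNj
  have hNj0 : Nj 0 = K + 1 := by simp [hNj]
  have hNj_succ : ∀ j, Nj (j + 1) + 1 = 2 * Nj j := by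
    intro j; simp only [hNj, pow_succ]; ring
  have hNj_ge : ∀ j, K + 1 ≤ Nj j := by
    intro j
    have : 1 ≤ 2 ^ j := Nat.one_le_two_pow
    simp only [hNj]
    nlinarith
  have hNj_mono : ∀ j, Nj j ≤ Nj (j + 1) := by
    intro j; have := hNj_succ j; have := hNj_ge j; omega
  have hNj_real : ∀ j, ((Nj (j + 1) : ℕ) : ℝ) - 1 = 2 * (((Nj j : ℕ) : ℝ) - 1) := by
    intro j
    have h1 : ((Nj (j + 1) + 1 : ℕ) : ℝ) = ((2 * Nj j : ℕ) : ℝ) := by rw [hNj_succ j]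
    push_cast at h1
    linarith
  have hNj_pos : ∀ j, (0 : ℝ) < ((Nj j : ℕ) : ℝ) - 1 := by
    intro j
    have := hNj_ge j
    have : (K + 1 : ℝ) ≤ ((Nj j : ℕ) : ℝ) := by exact_mod_cast this
    have hK' : (1 : ℝ) ≤ K := by exact_mod_cast hK
    linarith
  -- induction along the doubling sequence
  have P : ∀ j, D (K + 1) ≤ D (Nj j) ∧ ∀ M, K + 1 ≤ M → M ≤ Nj j → D (K + 1) / 2 ≤ D M := by
    intro j
    induction j with
    | zero =>
      refine ⟨by rw [hNj0], fun M h1 h2 => ?_⟩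
      rw [hNj0] at h2
      obtain rfl : M = K + 1 := le_antisymm h2 h1
      linarith
    | succ j ih =>
      obtain ⟨ih1, ih2⟩ := ih
      have hDNj : 0 ≤ D (Nj j) := le_trans hpos ih1
      have hmono : D (K + 1) ≤ D (Nj (j + 1)) := by
        have hh := h (Nj j) (hNj_ge j) (Nj (j + 1)) (hNj_mono j) (hNj_succ j).le
        rw [hNj_real j] at hh
        -- 2 (Nj j - 1) D (Nj j) ≤ 2 (Nj j - 1) D (Nj (j+1))
        have hp := hNj_pos j
        have : D (Nj j) ≤ D (Nj (j + 1)) := by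
          by_contra hc
          push Not at hc
          nlinarith
        exact ih1.trans this
      refine ⟨hmono, fun M h1 h2 => ?_⟩
      by_cases hM : M ≤ Nj j
      · exact ih2 M h1 hM
      · push Not at hM
        have hM2 : M + 1 ≤ 2 * Nj j := by have := hNj_succ j; omega
        have hh := h (Nj j) (hNj_ge j) M hM.le hM2
        -- (M-1) D(Nj j) ≤ 2 (Nj j - 1) D M, with D (Nj j) ≥ D (K+1) ≥ 0 and M - 1 ≥ Nj j - 1 > 0
        have hMr : ((Nj j : ℕ) : ℝ) - 1 ≤ (M : ℝ) - 1 := by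
          have : ((Nj j : ℕ) : ℝ) ≤ (M : ℝ) := by exact_mod_cast hM.le
          linarith
        have hp := hNj_pos j
        have h3 : ((M : ℝ) - 1) * D (K + 1) ≤ 2 * (((Nj j : ℕ) : ℝ) - 1) * D M :=
          le_trans (mul_le_mul_of_nonneg_left ih1 (by linarith)) hh
        -- from h3: D M ≥ (M-1)/(2(Nj j -1)) D(K+1) ≥ D(K+1)/2
        by_contra hc
        push Not at hc
        -- D M < D(K+1)/2 ⇒ 2 (Nj j - 1) D M < (Nj j - 1) D (K+1) ≤ (M - 1) D(K+1)
        nlinarith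
  intro M hM
  have hMle : M ≤ Nj M := by
    have h2 : M < 2 ^ M := Nat.lt_two_pow_self
    simp only [hNj]
    nlinarith
  exact (P M).2 M hM hMle



/-- Dyadic covering: every `n ≥ n₀ ≥ 1` lies in a block `[2^k n₀, 2^(k+1) n₀]`. -/
theorem exists_dyadic_block {n₀ n : ℕ} (hn₀ : 1 ≤ n₀) (hn : n₀ ≤ n) :
    ∃ k : ℕ, 2 ^ k * n₀ ≤ n ∧ n ≤ 2 ^ (k + 1) * n₀ := by
  set q := n / n₀ with hq
  have hq1 : 1 ≤ q := (Nat.le_div_iff_mul_le hn₀).mpr (by simpa using hn)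
  have hqn : q ≠ 0 := by omega
  refine ⟨Nat.log 2 q, ?_, ?_⟩
  · calc 2 ^ Nat.log 2 q * n₀ ≤ q * n₀ := Nat.mul_le_mul_right _ (Nat.pow_log_le_self 2 hqn)
      _ ≤ n := Nat.div_mul_le_self n n₀
  · have h1 : q < 2 ^ (Nat.log 2 q + 1) := Nat.lt_pow_succ_log_self (by norm_num) q
    have h2 : n < (q + 1) * n₀ := by
      have := Nat.lt_div_mul_add (a := n) (b := n₀) (by omega)
      rw [hq]; linarith [this]
    calc n ≤ (q + 1) * n₀ := h2.le
      _ ≤ 2 ^ (Nat.log 2 q + 1) * n₀ := Nat.mul_le_mul_right _ h1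

/-- **Quasi-subadditivity with a dyadically summable defect gives linear growth** (de Bruijn–Erdős,
dyadic form). `R (n+m) ≤ R n + R m + F (n+m)` for `n, m ≥ n₀`, `F ≥ 0` monotone with bounded dyadic
sums `∑_{i<k} F(2^(i+2) n₀)/(2^(i+1) n₀) ≤ B`, and `R n ≤ A₀ n` on the first block
`[n₀, 2 n₀]`, imply `R n ≤ (A₀ + B) n` for all `n ≥ n₀`. -/
theorem seq_linear_of_quasiSubadditive {R F : ℕ → ℝ} {n₀ : ℕ} (hn₀ : 1 ≤ n₀)
    (hsub : ∀ n m, n₀ ≤ n → n₀ ≤ m → R (n + m) ≤ R n + R m + F (n + m))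
    (hF0 : ∀ n, 0 ≤ F n) (hFmono : Monotone F)
    {B : ℝ} (hB : ∀ k, ∑ i ∈ range k, F (2 ^ (i + 2) * n₀) / (2 ^ (i + 1) * n₀) ≤ B)
    {A₀ : ℝ} (hA₀ : ∀ n, n₀ ≤ n → n ≤ 2 * n₀ → R n ≤ A₀ * n) :
    ∀ n, n₀ ≤ n → R n ≤ (A₀ + B) * n := by
  -- S k := the k-th dyadic partial sum
  set S : ℕ → ℝ := fun k => ∑ i ∈ range k, F (2 ^ (i + 2) * n₀) / (2 ^ (i + 1) * n₀) with hS
  -- block induction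
  have block : ∀ k n, 2 ^ k * n₀ ≤ n → n ≤ 2 ^ (k + 1) * n₀ → R n ≤ (A₀ + S k) * n := by
    intro k
    induction k with
    | zero =>
      intro n h1 h2
      simp only [pow_zero, one_mul] at h1
      simp only [zero_add, pow_one] at h2
      simpa [hS] using hA₀ n h1 h2
    | succ k ih =>
      intro n h1 h2
      -- split n = m + m'
      set m := n / 2 with hm
      set m' := n - n / 2 with hm'
      have hn : n = m + m' := by omega
      have hpowpos : 1 ≤ 2 ^ k := Nat.one_le_two_pow
      set P := 2 ^ k * n₀ with hP
      have hP1 : 2 ^ (k + 1) * n₀ = 2 * P := by rw [hP]; ring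
      have hP2 : 2 ^ (k + 1 + 1) * n₀ = 4 * P := by rw [hP]; ring
      rw [hP1] at h1
      rw [hP2] at h2
      have hm1 : P ≤ m := by omega
      have hm2 : m ≤ 2 ^ (k + 1) * n₀ := by rw [hP1]; omega
      have hm'1 : P ≤ m' := by omega
      have hm'2 : m' ≤ 2 ^ (k + 1) * n₀ := by rw [hP1]; omega
      have hmn₀ : n₀ ≤ m := le_trans (Nat.le_mul_of_pos_left n₀ (by positivity)) hm1
      have hm'n₀ : n₀ ≤ m' := le_trans (Nat.le_mul_of_pos_left n₀ (by positivity)) hm'1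
      have hRm := ih m hm1 hm2
      have hRm' := ih m' hm'1 hm'2
      have hsub' := hsub m m' hmn₀ hm'n₀
      rw [← hn] at hsub'
      -- F n ≤ F (2^(k+2) n₀) and n ≥ 2^(k+1) n₀
      have hFn : F n ≤ F (2 ^ (k + 2) * n₀) := hFmono (by rw [show k + 2 = k + 1 + 1 from rfl, hP2]; exact h2)
      have hn1 : ((2 : ℝ) ^ (k + 1) * n₀) ≤ (n : ℝ) := by
        have : 2 ^ (k + 1) * n₀ ≤ n := by rw [hP1]; exact h1
        exact_mod_cast this
      have hden : (0 : ℝ) < 2 ^ (k + 1) * n₀ := by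
        have : (1 : ℝ) ≤ n₀ := by exact_mod_cast hn₀
        positivity
      -- F n ≤ (F(2^(k+2) n₀) / (2^(k+1) n₀)) * n
      have hFn' : F n ≤ F (2 ^ (k + 2) * n₀) / (2 ^ (k + 1) * n₀) * n := by
        rw [div_mul_eq_mul_div, le_div_iff₀ hden]
        calc F n * (2 ^ (k + 1) * ↑n₀) ≤ F (2 ^ (k + 2) * n₀) * (2 ^ (k + 1) * ↑n₀) :=
              mul_le_mul_of_nonneg_right hFn hden.le
          _ ≤ F (2 ^ (k + 2) * n₀) * n := mul_le_mul_of_nonneg_left hn1 (hF0 _)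
      have hSsucc : S (k + 1) = S k + F (2 ^ (k + 2) * n₀) / (2 ^ (k + 1) * n₀) := by
        simp only [hS, Finset.sum_range_succ]
      have hcast : ((m + m' : ℕ) : ℝ) = (m : ℝ) + (m' : ℝ) := by push_cast; ring
      calc R n ≤ R m + R m' + F n := hsub'
        _ ≤ (A₀ + S k) * m + (A₀ + S k) * m' + F (2 ^ (k + 2) * n₀) / (2 ^ (k + 1) * n₀) * n := by
            linarith
        _ = (A₀ + S (k + 1)) * n := by rw [hSsucc, hn, hcast]; ring
  intro n hn
  obtain ⟨k, hk1, hk2⟩ := exists_dyadic_block hn₀ hn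
  have h := block k n hk1 hk2
  have hnn : (0 : ℝ) ≤ n := by positivity
  calc R n ≤ (A₀ + S k) * n := h
    _ ≤ (A₀ + B) * n := mul_le_mul_of_nonneg_right (by linarith [hB k]) hnn


/-- Dyadic summability of a defect with the DOUBLING property `F (2n) ≤ 2ρ F n` (`0 ≤ ρ < 1`):
`∑_{i<k} F(2^(i+2) n₀)/(2^(i+1) n₀) ≤ (F (2 n₀) / n₀) · ρ / (1 - ρ)`. -/
theorem dyadic_sum_le_of_doubling {F : ℕ → ℝ} {n₀ : ℕ} (hn₀ : 1 ≤ n₀) {ρ : ℝ} (hρ0 : 0 ≤ ρ)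
    (hρ1 : ρ < 1) (hF0 : ∀ n, 0 ≤ F n) (hdbl : ∀ n, n₀ ≤ n → F (2 * n) ≤ 2 * ρ * F n) :
    ∀ k, ∑ i ∈ range k, F (2 ^ (i + 2) * n₀) / (2 ^ (i + 1) * n₀) ≤
      F (2 * n₀) / n₀ * (ρ / (1 - ρ)) := by
  have hn₀r : (0 : ℝ) < n₀ := by exact_mod_cast hn₀
  have hpow : ∀ i, F (2 ^ (i + 2) * n₀) ≤ (2 * ρ) ^ (i + 1) * F (2 * n₀) := by
    intro i
    induction i with
    | zero =>
      have h1 : 2 ^ (0 + 2) * n₀ = 2 * (2 * n₀) := by ring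
      have := hdbl (2 * n₀) (by omega)
      rw [h1]
      calc F (2 * (2 * n₀)) ≤ 2 * ρ * F (2 * n₀) := this
        _ = (2 * ρ) ^ (0 + 1) * F (2 * n₀) := by ring
    | succ i ih =>
      have h1 : 2 ^ (i + 1 + 2) * n₀ = 2 * (2 ^ (i + 2) * n₀) := by ring
      have h2 := hdbl (2 ^ (i + 2) * n₀)
        (le_trans (Nat.le_mul_of_pos_left n₀ (by positivity)) le_rfl)
      rw [h1]
      calc F (2 * (2 ^ (i + 2) * n₀)) ≤ 2 * ρ * F (2 ^ (i + 2) * n₀) := h2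
        _ ≤ 2 * ρ * ((2 * ρ) ^ (i + 1) * F (2 * n₀)) :=
            mul_le_mul_of_nonneg_left ih (by positivity)
        _ = (2 * ρ) ^ (i + 1 + 1) * F (2 * n₀) := by ring
  have hterm : ∀ i, F (2 ^ (i + 2) * n₀) / (2 ^ (i + 1) * n₀) ≤
      F (2 * n₀) / n₀ * ρ ^ (i + 1) := by
    intro i
    have hden : (0 : ℝ) < 2 ^ (i + 1) * n₀ := by positivity
    rw [div_le_iff₀ hden]
    calc F (2 ^ (i + 2) * n₀) ≤ (2 * ρ) ^ (i + 1) * F (2 * n₀) := hpow i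
      _ = F (2 * n₀) / n₀ * ρ ^ (i + 1) * (2 ^ (i + 1) * n₀) := by
          rw [mul_pow]; field_simp
  intro k
  calc ∑ i ∈ range k, F (2 ^ (i + 2) * n₀) / (2 ^ (i + 1) * n₀)
      ≤ ∑ i ∈ range k, F (2 * n₀) / n₀ * ρ ^ (i + 1) := Finset.sum_le_sum fun i _ => hterm i
    _ = F (2 * n₀) / n₀ * (ρ * ∑ i ∈ range k, ρ ^ i) := by
        rw [Finset.mul_sum, Finset.mul_sum]
        refine Finset.sum_congr rfl fun i _ => ?_
        ring
    _ ≤ F (2 * n₀) / n₀ * (ρ * (1 - ρ)⁻¹) := by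
        have hgeom : ∑ i ∈ range k, ρ ^ i ≤ (1 - ρ)⁻¹ := by
          rw [← tsum_geometric_of_lt_one hρ0 hρ1]
          exact (summable_geometric_of_lt_one hρ0 hρ1).sum_le_tsum _ (fun i _ => by positivity)
        have hF2 : 0 ≤ F (2 * n₀) / n₀ := div_nonneg (hF0 _) hn₀r.le
        exact mul_le_mul_of_nonneg_left (mul_le_mul_of_nonneg_left hgeom hρ0) hF2
    _ = F (2 * n₀) / n₀ * (ρ / (1 - ρ)) := by rw [div_eq_mul_inv ρ]

/-! ## §1 The crux frame -/

/-- The common frame of the crux family: all hypotheses of `ConductanceLowerBound`, with the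
conclusion replaced by `P ω₂ lam β γ T D`. -/
def InFrame (P : ℝ → ℝ → ℝ → ℝ → ℝ → (ℕ → ℝ) → Prop) : Prop :=
  ∀ ω₂ lam β γ : ℝ, 0 < ω₂ → 0 < lam → 0 < β → 0 < γ →
    (∀ (N : ℕ) (T_L T_R : ℝ), 0 < T_L → 0 < T_R → ∀ μ ν : Measure (PhaseSpace N),
      (pinnedChain ω₂ lam β γ).IsSteadyState N T_L T_R μ →
      (pinnedChain ω₂ lam β γ).IsSteadyState N T_L T_R ν → μ = ν) →
    ∀ μ : (N : ℕ) → ℝ → ℝ → Measure (PhaseSpace N),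
      (∀ (N : ℕ) (T_L T_R : ℝ), 0 < T_L → 0 < T_R →
        (pinnedChain ω₂ lam β γ).IsSteadyState N T_L T_R (μ N T_L T_R)) →
      ∀ T : ℝ, 0 < T → ∀ D : ℕ → ℝ,
        (∀ N : ℕ, Tendsto (fun δ : ℝ =>
          (pinnedChain ω₂ lam β γ).totalCurrent (μ N (T + δ / 2) (T - δ / 2)) / δ)
            (𝓝[≠] 0) (𝓝 (D N))) → P ω₂ lam β γ T D

/-- The crux is the frame with conclusion `∃ c > 0, ∃ N₁, ∀ N ≥ N₁, c ≤ D N`. -/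
theorem conductanceLowerBound_iff_inFrame :
    ConductanceLowerBound ↔
      InFrame (fun _ _ _ _ _ D => ∃ c : ℝ, 0 < c ∧ ∃ N₁ : ℕ, ∀ N : ℕ, N₁ ≤ N → c ≤ D N) :=
  Iff.rfl

/-- `PositiveConductance` (closed item stmt-11750) is the frame with conclusion `∀ N ≥ 2, 0 < D N`. -/
theorem positiveConductance_iff_inFrame :
    PositiveConductance ↔ InFrame (fun _ _ _ _ _ D => ∀ N : ℕ, 2 ≤ N → 0 < D N) :=
  Iff.rfl

/-- Frame transport with two premises (pointwise in the response sequence `D`). -/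
theorem InFrame.mono₂ {P Q R : ℝ → ℝ → ℝ → ℝ → ℝ → (ℕ → ℝ) → Prop}
    (hPQR : ∀ ω₂ lam β γ T D, P ω₂ lam β γ T D → Q ω₂ lam β γ T D → R ω₂ lam β γ T D) :
    InFrame P → InFrame Q → InFrame R := by
  intro hP hQ ω₂ lam β γ hω hl hβ hγ huniq μ hμ T hT D hD
  exact hPQR ω₂ lam β γ T D (hP ω₂ lam β γ hω hl hβ hγ huniq μ hμ T hT D hD)
    (hQ ω₂ lam β γ hω hl hβ hγ huniq μ hμ T hT D hD)

/-- Frame transport with one premise. -/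
theorem InFrame.mono {P Q : ℝ → ℝ → ℝ → ℝ → ℝ → (ℕ → ℝ) → Prop}
    (hPQ : ∀ ω₂ lam β γ T D, P ω₂ lam β γ T D → Q ω₂ lam β γ T D) :
    InFrame P → InFrame Q := by
  intro hP ω₂ lam β γ hω hl hβ hγ huniq μ hμ T hT D hD
  exact hPQ ω₂ lam β γ T D (hP ω₂ lam β γ hω hl hβ hγ huniq μ hμ T hT D hD)

/-! ## §2 (E3) Summable-defect monotone response -/

/-- **(E3) SUMMABLE-DEFECT MONOTONE RESPONSE.**  In the crux frame: beyond some `N₀ ≥ 2`,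
`(1 − a_N)·D_N ≤ D_{N+1}` with a defect sequence `0 ≤ a_N ≤ 1/2`, `Σ a_N < ∞`.
Weaker than s1's `MonotoneResponse` (`a ≡ 0`, `N₀ = 2`) and than instance LCR's
`EventualMonotoneResponse` (`a ≡ 0`); it answers s1's "zero slack" objection exactly: a SUMMABLE
relative defect is harmless, a defect `C/N` is not (`D_N ≳ N^{−C}` only).  In resistance terms the
step says `R_{N+1} − R_N ≤ R_N/(N−1) + O(a_N R_N)`: the incremental resistance of one added site is
at most the running average per bond plus a summable relative error — for a Fourier conductor
`R_N = r_c + (N−1)/κ` the available slack is the contact term `r_c/(N−1)` plus `a_N R_N`. -/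
def SummableDefectMonotone : Prop :=
  InFrame fun _ _ _ _ _ D => ∃ N₀ : ℕ, 2 ≤ N₀ ∧ ∃ a : ℕ → ℝ, (∀ N, 0 ≤ a N) ∧
    (∀ N, N₀ ≤ N → a N ≤ 1 / 2) ∧ Summable a ∧ ∀ N, N₀ ≤ N → (1 - a N) * D N ≤ D (N + 1)

/-- **`SummableDefectMonotone → PositiveConductance → ConductanceLowerBound`** (PROVED):
`c := D_{N₀}·exp(−2Σa) > 0`. -/
theorem conductanceLowerBound_of_summableDefectMonotone
    (hS : SummableDefectMonotone) (hP : PositiveConductance) : ConductanceLowerBound := by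
  rw [conductanceLowerBound_iff_inFrame]
  rw [positiveConductance_iff_inFrame] at hP
  refine InFrame.mono₂ (fun ω₂ lam β γ T D h hpos => ?_) hS hP
  obtain ⟨N₀, hN₀, a, ha0, ha1, has, hstep⟩ := h
  have hD0 : 0 < D N₀ := hpos N₀ hN₀
  refine ⟨D N₀ * Real.exp (-2 * ∑' k, a k), by positivity, N₀, fun N hN => ?_⟩
  exact seq_floor_of_summableDefect ha0 ha1 has hstep hD0.le N hN

/-! ## §3 (E2) The halving law -/

/-- **(E2) HALVING LAW.**  In the crux frame: beyond some `N₀ ≥ 2`, for `N₀ ≤ N ≤ M ≤ 2N − 1`,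
`(M−1)·D_N ≤ 2(N−1)·D_M`, i.e. the per-bond transmission `G_L = D_L/(L−1)` at most HALVES when the
number of bonds at most DOUBLES: `G_M ≥ ½ G_N`.  The constant is sharp in both directions: for a
Fourier conductor `G_M/G_N = (r_c + (N−1)/κ)/(r_c + (M−1)/κ) ≥ ½` with slack `≍ r_c κ/N → 0`
(saturated iff the contact resistance vanishes), and any constant `θ < ½` in its place yields only
`D_N ≳ N^{−log₂(1/(2θ))}` (instance JL's `DoublingHarnack(θ)`, which therefore needs the extra piece
`DyadicFloor`).  With the sharp constant the comparison ALONE gives the floor. -/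
def HalvingLaw : Prop :=
  InFrame fun _ _ _ _ _ D => ∃ N₀ : ℕ, 2 ≤ N₀ ∧ ∀ N, N₀ ≤ N → ∀ M, N ≤ M → M + 1 ≤ 2 * N →
    ((M : ℝ) - 1) * D N ≤ 2 * ((N : ℝ) - 1) * D M

/-- **`HalvingLaw → PositiveConductance → ConductanceLowerBound`** (PROVED): `c := D_{N₀}/2`. -/
theorem conductanceLowerBound_of_halvingLaw
    (hH : HalvingLaw) (hP : PositiveConductance) : ConductanceLowerBound := by
  rw [conductanceLowerBound_iff_inFrame]
  rw [positiveConductance_iff_inFrame] at hP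
  refine InFrame.mono₂ (fun ω₂ lam β γ T D h hpos => ?_) hH hP
  obtain ⟨N₀, hN₀, h⟩ := h
  have hD0 : 0 < D N₀ := hpos N₀ hN₀
  exact ⟨D N₀ / 2, by positivity, N₀, seq_floor_of_halving hN₀ h hD0.le⟩

/-- Instance LCR's `EventualMonotoneResponse`, restated: beyond some `N₀ ≥ 2`, `D_N ≤ D_{N+1}`. -/
def EventuallyMonotoneResponse : Prop :=
  InFrame fun _ _ _ _ _ D => ∃ N₀ : ℕ, 2 ≤ N₀ ∧ ∀ N, N₀ ≤ N → D N ≤ D (N + 1)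

/-- **`EventuallyMonotoneResponse → PositiveConductance → HalvingLaw`** (PROVED): eventual
monotonicity is the `M = N+1` case iterated; the halving law is its dyadic-scale weakening. -/
theorem halvingLaw_of_eventuallyMonotone
    (hM : EventuallyMonotoneResponse) (hP : PositiveConductance) : HalvingLaw := by
  unfold HalvingLaw
  rw [positiveConductance_iff_inFrame] at hP
  refine InFrame.mono₂ (fun ω₂ lam β γ T D h hpos => ?_) hM hP
  obtain ⟨N₀, hN₀, hmono⟩ := h
  refine ⟨N₀, hN₀, fun N hN M hNM hM2 => ?_⟩
  -- monotone chain D N ≤ D M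
  have hchain : D N ≤ D M := by
    induction M, hNM using Nat.le_induction with
    | base => exact le_rfl
    | succ m hm ih =>
      exact (ih (by omega)).trans (hmono m (le_trans hN hm))
  have hDM : 0 ≤ D M := (hpos M (by omega)).le
  have hM1 : (M : ℝ) - 1 ≤ 2 * ((N : ℝ) - 1) := by
    have : ((M + 1 : ℕ) : ℝ) ≤ ((2 * N : ℕ) : ℝ) := by exact_mod_cast hM2
    push_cast at this
    linarith
  have hM0 : (0 : ℝ) ≤ (M : ℝ) - 1 := by
    have : (2 : ℝ) ≤ M := by exact_mod_cast (show 2 ≤ M by omega)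
    linarith
  calc ((M : ℝ) - 1) * D N ≤ ((M : ℝ) - 1) * D M := mul_le_mul_of_nonneg_left hchain hM0
    _ ≤ 2 * ((N : ℝ) - 1) * D M := mul_le_mul_of_nonneg_right hM1 hDM

/-! ## §4 (E1) The sub-linear-defect series law (de Bruijn–Erdős supplier) -/

/-- **(E1) SUB-LINEAR-DEFECT SERIES LAW.**  In the crux frame, with the bath-to-bath resistances
`R_N := (N−1)/D_N`: `∃ C ≥ 0, 0 ≤ θ < 1, ∀ N, M ≥ 2, R_{N+M} ≤ R_N + R_M + C·(N+M)^θ`.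
Route FeketeSeriesLaw's crux `QuasiSubadditiveResistance` (stmt-14041) is the case `θ = 0`
(`sublinearSeriesLaw_of_quasiSubadditiveResistance`); the present statement tolerates junction
defects growing like any power `< 1` of the length — in particular finite-size corrections to
`D_N` decaying SLOWER than `1/N`, the failure mode recorded on stmt-14041 — and still implies the
crux (de Bruijn–Erdős in place of Fekete).  Physically the defect is NEGATIVE for a Fourier
conductor (`R_{N+M} − R_N − R_M ≈ −2r_c`, j021937: `r_c ≈ 5` at unit parameters), so the slack is
`2r_c + C(N+M)^θ → ∞`.  It is the weakest series-law-type sufficient condition on record; its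
content is still a comparison of the `(N+M)`-chain with its two bathed pieces (non-localisation at
the junction scale, with polynomial tolerance), for which no monotonicity principle is known. -/
def SublinearSeriesLaw : Prop :=
  InFrame fun _ _ _ _ _ D => ∃ C θ : ℝ, 0 ≤ C ∧ 0 ≤ θ ∧ θ < 1 ∧ ∀ N M : ℕ, 2 ≤ N → 2 ≤ M →
    ((N : ℝ) + M - 1) / D (N + M) ≤
      ((N : ℝ) - 1) / D N + ((M : ℝ) - 1) / D M + C * ((N : ℝ) + M) ^ θ

/-- **`SublinearSeriesLaw → PositiveConductance → ConductanceLowerBound`** (PROVED; de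
Bruijn–Erdős via dyadic blocks: `R_N ≤ K·N` for `N ≥ 2`, hence `D_N ≥ 1/(2K)`). -/
theorem conductanceLowerBound_of_sublinearSeriesLaw
    (hS : SublinearSeriesLaw) (hP : PositiveConductance) : ConductanceLowerBound := by
  rw [conductanceLowerBound_iff_inFrame]
  rw [positiveConductance_iff_inFrame] at hP
  refine InFrame.mono₂ (fun ω₂ lam β γ T D h hpos => ?_) hS hP
  obtain ⟨C, θ, hC, hθ0, hθ1, hsub⟩ := h
  -- resistances and defect
  set R : ℕ → ℝ := fun n => ((n : ℝ) - 1) / D n with hR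
  set F : ℕ → ℝ := fun n => C * ((n : ℕ) : ℝ) ^ θ with hF
  have hRpos : ∀ n, 2 ≤ n → 0 < R n := by
    intro n hn
    have : (2 : ℝ) ≤ n := by exact_mod_cast hn
    exact div_pos (by linarith) (hpos n hn)
  have hsub' : ∀ n m, 2 ≤ n → 2 ≤ m → R (n + m) ≤ R n + R m + F (n + m) := by
    intro n m hn hm
    have := hsub n m hn hm
    simp only [hR, hF]
    push_cast
    linarith [this]
  have hF0 : ∀ n, 0 ≤ F n := fun n => by
    simp only [hF]; exact mul_nonneg hC (Real.rpow_nonneg (Nat.cast_nonneg n) θ)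
  have hFmono : Monotone F := by
    intro n m hnm
    simp only [hF]
    exact mul_le_mul_of_nonneg_left
      (Real.rpow_le_rpow (Nat.cast_nonneg n) (by exact_mod_cast hnm) hθ0) hC
  -- doubling with ratio ρ = 2^θ / 2 < 1
  set ρ : ℝ := (2 : ℝ) ^ θ / 2 with hρ
  have hρ0 : 0 ≤ ρ := by positivity
  have hρ1 : ρ < 1 := by
    have : (2 : ℝ) ^ θ < (2 : ℝ) ^ (1 : ℝ) :=
      Real.rpow_lt_rpow_of_exponent_lt (by norm_num) hθ1
    rw [Real.rpow_one] at this
    rw [hρ, div_lt_one (by norm_num)]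
    exact this
  have hdbl : ∀ n, 2 ≤ n → F (2 * n) ≤ 2 * ρ * F n := by
    intro n _
    simp only [hF, hρ]
    have h2n : (((2 * n : ℕ)) : ℝ) = 2 * (n : ℝ) := by push_cast; ring
    rw [h2n, Real.mul_rpow (by norm_num) (Nat.cast_nonneg n)]
    apply le_of_eq; ring
  have hB := dyadic_sum_le_of_doubling (n₀ := 2) (by norm_num) hρ0 hρ1 hF0 hdbl
  -- first block [2, 4]
  set A₀ : ℝ := R 2 + R 3 + R 4 with hA₀
  have hA₀pos : 0 < A₀ := by
    have := hRpos 2 le_rfl; have := hRpos 3 (by norm_num); have := hRpos 4 (by norm_num)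
    simp only [hA₀]; linarith
  have hblock : ∀ n, 2 ≤ n → n ≤ 2 * 2 → R n ≤ A₀ * n := by
    intro n h1 h2
    have h2' : R 2 ≤ A₀ := by
      have := hRpos 3 (by norm_num); have := hRpos 4 (by norm_num); simp only [hA₀]; linarith
    have h3' : R 3 ≤ A₀ := by
      have := hRpos 2 le_rfl; have := hRpos 4 (by norm_num); simp only [hA₀]; linarith
    have h4' : R 4 ≤ A₀ := by
      have := hRpos 2 le_rfl; have := hRpos 3 (by norm_num); simp only [hA₀]; linarith
    have hn1 : (1 : ℝ) ≤ n := by exact_mod_cast (show 1 ≤ n by omega)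
    have hA : A₀ ≤ A₀ * n := by nlinarith
    interval_cases n
    · exact h2'.trans hA
    · exact h3'.trans hA
    · exact h4'.trans hA
  -- de Bruijn–Erdős
  set B : ℝ := F (2 * 2) / (2 : ℕ) * (ρ / (1 - ρ)) with hBdef
  have hlin := seq_linear_of_quasiSubadditive (n₀ := 2) (by norm_num) hsub' hF0 hFmono
    (B := B) (fun k => by simpa [hBdef] using hB k) (A₀ := A₀) hblock
  have hB0 : 0 ≤ B := by
    simp only [hBdef]
    have : 0 ≤ ρ / (1 - ρ) := div_nonneg hρ0 (by linarith)
    exact mul_nonneg (div_nonneg (hF0 _) (by norm_num)) this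
  set K : ℝ := A₀ + B with hK
  have hKpos : 0 < K := by simp only [hK]; linarith
  refine ⟨1 / (2 * K), by positivity, 2, fun n hn => ?_⟩
  have hRn : R n ≤ K * n := hlin n hn
  have hDn : 0 < D n := hpos n hn
  have hn2 : (2 : ℝ) ≤ n := by exact_mod_cast hn
  -- (n-1)/D n ≤ K n  ⇒  D n ≥ (n-1)/(K n) ≥ 1/(2K)
  have h1 : ((n : ℝ) - 1) ≤ K * n * D n := by
    have := hRn; simp only [hR] at this
    rwa [div_le_iff₀ hDn] at this
  rw [div_le_iff₀ (by positivity)]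
  nlinarith

/-- **`QuasiSubadditiveResistance → SublinearSeriesLaw`** (PROVED): route FeketeSeriesLaw's crux
(stmt-14041, constant defect `C`) is the case `θ = 0` (with `max C 0`). -/
theorem sublinearSeriesLaw_of_quasiSubadditiveResistance
    (h : Summit.AtomisticToContinuum.FouriersLaw.Theses.FeketeSeriesLaw.QuasiSubadditiveResistance) :
    SublinearSeriesLaw := by
  intro ω₂ lam β γ hω hl hβ hγ huniq μ hμ T hT D hD
  obtain ⟨C, hC⟩ := h ω₂ lam β γ hω hl hβ hγ huniq μ hμ T hT D hD
  refine ⟨max C 0, 0, le_max_right _ _, le_rfl, by norm_num, fun N M hN hM => ?_⟩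
  have h1 := hC N M hN hM
  have e1 : ((N + M - 1 : ℕ) : ℝ) = (N : ℝ) + M - 1 := by
    rw [Nat.cast_sub (by omega)]; push_cast; ring
  have e2 : ((N - 1 : ℕ) : ℝ) = (N : ℝ) - 1 := by
    rw [Nat.cast_sub (by omega)]; push_cast; ring
  have e3 : ((M - 1 : ℕ) : ℝ) = (M : ℝ) - 1 := by
    rw [Nat.cast_sub (by omega)]; push_cast; ring
  rw [e1, e2, e3] at h1
  rw [Real.rpow_zero, mul_one]
  linarith [le_max_left C 0]

end Summit.AtomisticToContinuum.FouriersLaw.Cruxes.ConductanceLowerBound.StrategyCensusS2EDM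

end
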